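import Summits.FinalStateConjecture.FinalStateConjecture.Theses.BondiDrainDispersal
import Summits.FinalStateConjecture.FinalStateConjecture.Theorems.BondiDrainDispersalDrainImpliesDisperseReduction
import HarnessLib.Audit

/-!
# Restatement surgery for crux stmt-FinalStateConjecture-17283 `BondiDrainDispersal.DrainImpliesDisperse` (lead c6, 2026-08-17)

Scratch file for the PLANNER (kernel-checked against the tree; nothing here is proposed to the tree by this seat —
route files and statement items are planner business, D-0014/D-0019). It spells out, fully qualified and in the
route file's style, the restatements recommended in `Cruxes/DrainImpliesDisperse/REPORT-c6.md`, and proves that the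
route's deciding theorem survives each of them:

* `DrainImpliesDisperseH`  (C‴) — the item AS FILED plus the ray-theoretic NO-EVENT-HORIZON hypothesis of
  `CensoredHorizonlessDisperse` (verbatim). Strictly WEAKER than the item as filed (`drainImpliesDisperseH_of`), and
  the route's assembly needs nothing more (`closes_H`): in `closes` the factor `DrainImpliesDisperse` is only ever
  applied inside the horizonless branch, where the horizonless hypothesis is in context. This removes the
  'massless hole' channel (a horizon persisting while `M_B → 0`, excluded only by an unproved late-cut Penrose
  inequality) from the crux at zero cost to the route.
* `DrainImpliesDisperseCKH` (C″) — C‴ restricted to data which are moreover Christodoulou–Klainerman strongly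
  asymptotically flat on a sole end (REPORT-c3 §5 R1: the regularity repair). This is the honest open core of the
  route's dispersive sector: "a censored, HORIZONLESS, drained MGHD of CK-admissible data disperses (honest `N = 0`
  decomposition)". With the Statement kept over the Dafermos–Rodnianski class (no human ruling), the route closes
  from C″ by the surgery R4 (`closes_R4`): the generic branch absorbs the rough (DR ∖ CK) horizonless data
  (`GenericCensoredHolesSettleR4`), where lead c3's focusing witnesses live and where they are expected to be
  tame-exceptional (REPORT-c3 §4).
* `DrainImpliesDisperseCK` (C′, lead c3/c5) — CK restriction WITHOUT the horizonless hypothesis: the form the twin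
  route `NoNullFinalMomentum` (whose case split is drain / no-drain, with no horizon predicate in context) can consume;
  C′ → C″ (`drainImpliesDisperseCKH_of_CK`).

All four cruxes keep their binder conventions; every proof is pure logic (case splits, monotonicity of tame
genericity in the property — the SAME end and the SAME tame immersed injective family serve the smaller exceptional
set, exactly as in `closes`).
-/

noncomputable section

open scoped Manifold ContDiff Topology
open Filter Set Topology Literature.Geometry.Lorentzian

namespace Summit.FinalStateConjecture.FinalStateConjecture.Cruxes.DrainImpliesDisperse.Surgery

open Summit.FinalStateConjecture.FinalStateConjecture.Theses.BondiDrainDispersal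
  (DrainImpliesDisperse CensoredHorizonlessDisperse HorizonlessMustDrain GenericCensoredHolesSettle)

set_option linter.unusedVariables false
set_option linter.dupNamespace false

/-- **C‴ — `DrainImpliesDisperse` with the ray-theoretic horizonless hypothesis** (verbatim the hypothesis of
`CensoredHorizonlessDisperse`, inserted between complete `𝓘⁺` and the drain). [folklore] -/
def DrainImpliesDisperseH : Prop :=
  ∀ (X : Type) [TopologicalSpace X] [ChartedSpace Literature.Geometry.Lorentzian.E3 X]
    [IsManifold (𝓡 3) ((⊤ : ℕ∞) : WithTop ℕ∞) X] [T2Space X] [SecondCountableTopology X] [ConnectedSpace X],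
    ∀ D ∈ Literature.Geometry.Lorentzian.admissibleVacuumData X,
    ∀ 𝒟 : Literature.Geometry.Lorentzian.VacuumCauchyDevelopment D, 𝒟.IsMaximal →
      Summit.FinalStateConjecture.HasCompleteNullInfinity 𝒟.toCauchyDevelopment →
      ¬ (∀ [𝒟.metric.HasLeviCivita], ∃ q : 𝒟.carrier, ∀ (p : X) (γ : ℝ → 𝒟.carrier) (dom : Set ℝ),
          𝒟.metric.IsNormalisedNullRayFrom 𝒟.timeOrientation 𝒟.embed 𝒟.normal p γ dom → ¬ BddAbove dom →
          q ∉ 𝒟.metric.chronologicalPast 𝒟.timeOrientation (γ '' (dom ∩ Set.Ici 0))) →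
      𝒟.toCauchyDevelopment.HasVanishingFinalBondiMass →
      ∃ (O : Set 𝒟.carrier) (d : Literature.Geometry.Lorentzian.FinalStateDecomposition 𝒟.toSpacetime O 2),
        d.N = 0 ∧ O = Summit.FinalStateConjecture.exteriorOf 𝒟.toCauchyDevelopment d.charted ∧
          Summit.FinalStateConjecture.RaysStayInClosure 𝒟.toCauchyDevelopment O ∧
          Summit.FinalStateConjecture.HasExhaustiveCharts d ∧ Summit.FinalStateConjecture.IsFutureOriented d

/-- **C″ — C‴ restricted to CK-admissible data** (the honest open core of the route's dispersive sector).
[cite: Christodoulou1999, p. A24] -/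
def DrainImpliesDisperseCKH : Prop :=
  ∀ (X : Type) [TopologicalSpace X] [ChartedSpace Literature.Geometry.Lorentzian.E3 X]
    [IsManifold (𝓡 3) ((⊤ : ℕ∞) : WithTop ℕ∞) X] [T2Space X] [SecondCountableTopology X] [ConnectedSpace X],
    ∀ D ∈ Literature.Geometry.Lorentzian.admissibleVacuumData X,
      (∃ (e : Literature.Geometry.Lorentzian.AFEnd X) (M : ℝ), e.IsSoleEnd ∧ e.IsStronglyAsymptoticallyFlatCK D M) →
    ∀ 𝒟 : Literature.Geometry.Lorentzian.VacuumCauchyDevelopment D, 𝒟.IsMaximal →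
      Summit.FinalStateConjecture.HasCompleteNullInfinity 𝒟.toCauchyDevelopment →
      ¬ (∀ [𝒟.metric.HasLeviCivita], ∃ q : 𝒟.carrier, ∀ (p : X) (γ : ℝ → 𝒟.carrier) (dom : Set ℝ),
          𝒟.metric.IsNormalisedNullRayFrom 𝒟.timeOrientation 𝒟.embed 𝒟.normal p γ dom → ¬ BddAbove dom →
          q ∉ 𝒟.metric.chronologicalPast 𝒟.timeOrientation (γ '' (dom ∩ Set.Ici 0))) →
      𝒟.toCauchyDevelopment.HasVanishingFinalBondiMass →
      ∃ (O : Set 𝒟.carrier) (d : Literature.Geometry.Lorentzian.FinalStateDecomposition 𝒟.toSpacetime O 2),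
        d.N = 0 ∧ O = Summit.FinalStateConjecture.exteriorOf 𝒟.toCauchyDevelopment d.charted ∧
          Summit.FinalStateConjecture.RaysStayInClosure 𝒟.toCauchyDevelopment O ∧
          Summit.FinalStateConjecture.HasExhaustiveCharts d ∧ Summit.FinalStateConjecture.IsFutureOriented d

/-- **C′ — `DrainImpliesDisperse` restricted to CK-admissible data, no horizonless hypothesis** (lead c3 §5 R1 / c5;
the form the twin route `NoNullFinalMomentum` can consume). [cite: Christodoulou1999, p. A24] -/
def DrainImpliesDisperseCK : Prop :=
  ∀ (X : Type) [TopologicalSpace X] [ChartedSpace Literature.Geometry.Lorentzian.E3 X]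
    [IsManifold (𝓡 3) ((⊤ : ℕ∞) : WithTop ℕ∞) X] [T2Space X] [SecondCountableTopology X] [ConnectedSpace X],
    ∀ D ∈ Literature.Geometry.Lorentzian.admissibleVacuumData X,
      (∃ (e : Literature.Geometry.Lorentzian.AFEnd X) (M : ℝ), e.IsSoleEnd ∧ e.IsStronglyAsymptoticallyFlatCK D M) →
    ∀ 𝒟 : Literature.Geometry.Lorentzian.VacuumCauchyDevelopment D, 𝒟.IsMaximal →
      Summit.FinalStateConjecture.HasCompleteNullInfinity 𝒟.toCauchyDevelopment →
      𝒟.toCauchyDevelopment.HasVanishingFinalBondiMass →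
      ∃ (O : Set 𝒟.carrier) (d : Literature.Geometry.Lorentzian.FinalStateDecomposition 𝒟.toSpacetime O 2),
        d.N = 0 ∧ O = Summit.FinalStateConjecture.exteriorOf 𝒟.toCauchyDevelopment d.charted ∧
          Summit.FinalStateConjecture.RaysStayInClosure 𝒟.toCauchyDevelopment O ∧
          Summit.FinalStateConjecture.HasExhaustiveCharts d ∧ Summit.FinalStateConjecture.IsFutureOriented d

/-- **`CensoredHorizonlessDisperse` restricted to CK-admissible data** (the matching restatement of item 17284).
[cite: Christodoulou1999, p. A24] -/
def CensoredHorizonlessDisperseCK : Prop :=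
  ∀ (X : Type) [TopologicalSpace X] [ChartedSpace Literature.Geometry.Lorentzian.E3 X]
    [IsManifold (𝓡 3) ((⊤ : ℕ∞) : WithTop ℕ∞) X] [T2Space X] [SecondCountableTopology X] [ConnectedSpace X],
    ∀ D ∈ Literature.Geometry.Lorentzian.admissibleVacuumData X,
      (∃ (e : Literature.Geometry.Lorentzian.AFEnd X) (M : ℝ), e.IsSoleEnd ∧ e.IsStronglyAsymptoticallyFlatCK D M) →
    ∀ 𝒟 : Literature.Geometry.Lorentzian.VacuumCauchyDevelopment D, 𝒟.IsMaximal →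
      Summit.FinalStateConjecture.HasCompleteNullInfinity 𝒟.toCauchyDevelopment →
      ¬ (∀ [𝒟.metric.HasLeviCivita], ∃ q : 𝒟.carrier, ∀ (p : X) (γ : ℝ → 𝒟.carrier) (dom : Set ℝ),
          𝒟.metric.IsNormalisedNullRayFrom 𝒟.timeOrientation 𝒟.embed 𝒟.normal p γ dom → ¬ BddAbove dom →
          q ∉ 𝒟.metric.chronologicalPast 𝒟.timeOrientation (γ '' (dom ∩ Set.Ici 0))) →
      ∃ (O : Set 𝒟.carrier) (d : Literature.Geometry.Lorentzian.FinalStateDecomposition 𝒟.toSpacetime O 2),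
        d.N = 0 ∧ O = Summit.FinalStateConjecture.exteriorOf 𝒟.toCauchyDevelopment d.charted ∧
          Summit.FinalStateConjecture.RaysStayInClosure 𝒟.toCauchyDevelopment O ∧
          Summit.FinalStateConjecture.HasExhaustiveCharts d ∧ Summit.FinalStateConjecture.IsFutureOriented d

/-- **R4 form of the generic branch**: `GenericCensoredHolesSettle` whose decomposition clause is demanded not only
when the MGHD has an event horizon but also when the datum is ROUGH (not CK on any sole end) — the generic branch
absorbs the rough horizonless data. [folklore] -/
def GenericCensoredHolesSettleR4 : Prop :=
  ∀ (X : Type) [TopologicalSpace X] [ChartedSpace Literature.Geometry.Lorentzian.E3 X]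
    [IsManifold (𝓡 3) ((⊤ : ℕ∞) : WithTop ℕ∞) X] [T2Space X] [SecondCountableTopology X] [ConnectedSpace X],
    Literature.Geometry.Lorentzian.InitialDataSet.IsTameChristodoulouGeneric
      (Literature.Geometry.Lorentzian.admissibleVacuumData X)
      (fun D ↦ (∃ 𝒟 : Literature.Geometry.Lorentzian.VacuumCauchyDevelopment D, 𝒟.IsMaximal) ∧
        ∀ 𝒟 : Literature.Geometry.Lorentzian.VacuumCauchyDevelopment D, 𝒟.IsMaximal →
          Summit.FinalStateConjecture.HasCompleteNullInfinity 𝒟.toCauchyDevelopment ∧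
          (((∀ [𝒟.metric.HasLeviCivita], ∃ q : 𝒟.carrier, ∀ (p : X) (γ : ℝ → 𝒟.carrier) (dom : Set ℝ),
              𝒟.metric.IsNormalisedNullRayFrom 𝒟.timeOrientation 𝒟.embed 𝒟.normal p γ dom → ¬ BddAbove dom →
              q ∉ 𝒟.metric.chronologicalPast 𝒟.timeOrientation (γ '' (dom ∩ Set.Ici 0))) ∨
            ¬ (∃ (e : Literature.Geometry.Lorentzian.AFEnd X) (M : ℝ),
                e.IsSoleEnd ∧ e.IsStronglyAsymptoticallyFlatCK D M)) →
            ∃ (O : Set 𝒟.carrier) (d : Literature.Geometry.Lorentzian.FinalStateDecomposition 𝒟.toSpacetime O 2),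
              (∀ i, Literature.Geometry.Lorentzian.Kerr.IsSubextremal (d.mass i) (d.spin i)) ∧
              O = Summit.FinalStateConjecture.exteriorOf 𝒟.toCauchyDevelopment d.charted ∧
              Summit.FinalStateConjecture.RaysStayInClosure 𝒟.toCauchyDevelopment O ∧
              Summit.FinalStateConjecture.HasExhaustiveCharts d ∧
              Summit.FinalStateConjecture.IsFutureOriented d)) 1

/-! ## Monotonicity: the restatements are WEAKER than the item as filed (nothing landed is lost) -/

/-- C‴ follows from the item as filed (drop the horizonless hypothesis). [folklore] -/
theorem drainImpliesDisperseH_of (h : DrainImpliesDisperse) : DrainImpliesDisperseH :=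
  fun X _ _ _ _ _ _ D hD 𝒟 h𝒟 hI _ hB ↦ h X D hD 𝒟 h𝒟 hI hB

/-- C′ follows from the item as filed (drop the CK hypothesis). [folklore] -/
theorem drainImpliesDisperseCK_of (h : DrainImpliesDisperse) : DrainImpliesDisperseCK :=
  fun X _ _ _ _ _ _ D hD _ 𝒟 h𝒟 hI hB ↦ h X D hD 𝒟 h𝒟 hI hB

/-- C″ follows from C‴. [folklore] -/
theorem drainImpliesDisperseCKH_of_H (h : DrainImpliesDisperseH) : DrainImpliesDisperseCKH :=
  fun X _ _ _ _ _ _ D hD _ 𝒟 h𝒟 hI hH hB ↦ h X D hD 𝒟 h𝒟 hI hH hB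

/-- C″ follows from C′. [folklore] -/
theorem drainImpliesDisperseCKH_of_CK (h : DrainImpliesDisperseCK) : DrainImpliesDisperseCKH :=
  fun X _ _ _ _ _ _ D hD hCK 𝒟 h𝒟 hI _ hB ↦ h X D hD hCK 𝒟 h𝒟 hI hB

/-! ## The line survives: C″ (hence C′-with-H) from a horizonless radiative end, through the landed reduction p149007 -/

/-- **C″ from the engine output.** If every censored, horizonless, drained MGHD of CK-admissible data carries a
horizonless radiative end (E1)–(E6) (the registered stub `stub_radiativeEnd_CK` of line `registered`, with the
horizonless hypothesis added), then C″ holds — by the landed reduction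
`Theorems.DrainImpliesDisperse.settles_of_horizonlessRadiativeEnd` (p149007). [folklore] -/
theorem drainImpliesDisperseCKH_of_radiativeEnd
    (h : ∀ (X : Type) [TopologicalSpace X] [ChartedSpace E3 X] [IsManifold (𝓡 3) ∞ X] [T2Space X]
      [SecondCountableTopology X] [ConnectedSpace X],
      ∀ D ∈ admissibleVacuumData X,
        (∃ (e : AFEnd X) (M : ℝ), e.IsSoleEnd ∧ e.IsStronglyAsymptoticallyFlatCK D M) →
        ∀ 𝒟 : VacuumCauchyDevelopment D, 𝒟.IsMaximal →
        Summit.FinalStateConjecture.HasCompleteNullInfinity 𝒟.toCauchyDevelopment →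
        ¬ (∀ [𝒟.metric.HasLeviCivita], ∃ q : 𝒟.carrier, ∀ (p : X) (γ : ℝ → 𝒟.carrier) (dom : Set ℝ),
            𝒟.metric.IsNormalisedNullRayFrom 𝒟.timeOrientation 𝒟.embed 𝒟.normal p γ dom → ¬ BddAbove dom →
            q ∉ 𝒟.metric.chronologicalPast 𝒟.timeOrientation (γ '' (dom ∩ Set.Ici 0))) →
        𝒟.toCauchyDevelopment.HasVanishingFinalBondiMass →
        ∃ (τ₀ : ℝ) (Ψ : Minkowski.background.domain → 𝒟.carrier),
          ContMDiff 𝓘(ℝ, E4) (𝓡 4) ∞ Ψ ∧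
          IsOpenEmbedding ((Minkowski.background.lateRegion τ₀).restrict Ψ) ∧
          IsClosed (Ψ '' {x : Minkowski.background.domain | τ₀ ≤ x.1 0}) ∧
          Ψ '' Minkowski.background.lateRegion τ₀ ⊆
            𝒟.metric.causalFuture 𝒟.timeOrientation (range 𝒟.embed) ∧
          (∀ x : Minkowski.background.domain, τ₀ ≤ x.1 0 →
            𝒟.metric.IsTimelike (mfderiv 𝓘(ℝ, E4) (𝓡 4) Ψ x (E4.basisVector 0)) ∧
            𝒟.timeOrientation.IsFutureDirected (mfderiv 𝓘(ℝ, E4) (𝓡 4) Ψ x (E4.basisVector 0))) ∧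
          Tendsto (fun τ ↦ 𝒟.toSpacetime.deviationCk Minkowski.background Ψ 2 τ) atTop (𝓝 0) ∧
          𝒟.metric.causalFuture 𝒟.timeOrientation (range 𝒟.embed) ⊆
            𝒟.metric.chronologicalPast 𝒟.timeOrientation (Ψ '' Minkowski.background.lateRegion τ₀)) :
    DrainImpliesDisperseCKH := by
  intro X _ _ _ _ _ _ D hD hCK 𝒟 h𝒟 hI hH hB
  obtain ⟨τ₀, Ψ, hsm, hemb, hcl, hJ, hT, hdec, hE6⟩ := h X D hD hCK 𝒟 h𝒟 hI hH hB
  exact Theorems.DrainImpliesDisperse.settles_of_horizonlessRadiativeEnd X D 𝒟.toCauchyDevelopment τ₀ Ψ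
    hsm hemb hcl hJ hT hdec hE6

/-! ## The route survives C‴ verbatim: `closes_H` -/

/-- The two strokes compose to the dispersive branch also in the H-form: no event horizon ⇒ drain (`hM`) ⇒ honest
`N = 0` decomposition (`hΔ`, which may use the horizonless hypothesis). [folklore] -/
theorem censoredHorizonlessDisperse_of_H (hM : HorizonlessMustDrain) (hΔ : DrainImpliesDisperseH) :
    CensoredHorizonlessDisperse := by
  intro X _ _ _ _ _ _ D hD 𝒟 h𝒟 hI hH
  exact hΔ X D hD 𝒟 h𝒟 hI hH (hM X D hD 𝒟 h𝒟 hI hH)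

/-- **The crux-only deciding argument** (rev-3 form of `closes`, re-proved: `CensoredHorizonlessDisperse →
GenericCensoredHolesSettle → FinalStateConjecture`). Verbatim the body of `Theses.BondiDrainDispersal.closes` after its
first `have`. [folklore] -/
theorem finalStateConjecture_of_censoredHorizonlessDisperse (hA : CensoredHorizonlessDisperse)
    (hG : GenericCensoredHolesSettle) : _root_.FinalStateConjecture := by
  intro X _ _ _ _ _ _ D hD
  have key : ∀ D' ∈ Literature.Geometry.Lorentzian.admissibleVacuumData X,
      ((∃ 𝒟 : Literature.Geometry.Lorentzian.VacuumCauchyDevelopment D', 𝒟.IsMaximal) ∧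
        ∀ 𝒟 : Literature.Geometry.Lorentzian.VacuumCauchyDevelopment D', 𝒟.IsMaximal →
          Summit.FinalStateConjecture.HasCompleteNullInfinity 𝒟.toCauchyDevelopment ∧
          ((∀ [𝒟.metric.HasLeviCivita], ∃ q : 𝒟.carrier, ∀ (p : X) (γ : ℝ → 𝒟.carrier) (dom : Set ℝ),
              𝒟.metric.IsNormalisedNullRayFrom 𝒟.timeOrientation 𝒟.embed 𝒟.normal p γ dom →
              ¬ BddAbove dom → q ∉ 𝒟.metric.chronologicalPast 𝒟.timeOrientation (γ '' (dom ∩ Set.Ici 0))) →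
            ∃ (O : Set 𝒟.carrier) (d : Literature.Geometry.Lorentzian.FinalStateDecomposition 𝒟.toSpacetime O 2),
              (∀ i, Literature.Geometry.Lorentzian.Kerr.IsSubextremal (d.mass i) (d.spin i)) ∧
              O = Summit.FinalStateConjecture.exteriorOf 𝒟.toCauchyDevelopment d.charted ∧
              Summit.FinalStateConjecture.RaysStayInClosure 𝒟.toCauchyDevelopment O ∧
              Summit.FinalStateConjecture.HasExhaustiveCharts d ∧
              Summit.FinalStateConjecture.IsFutureOriented d)) →
      ((∃ 𝒟 : Literature.Geometry.Lorentzian.VacuumCauchyDevelopment D', 𝒟.IsMaximal) ∧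
        ∀ 𝒟 : Literature.Geometry.Lorentzian.VacuumCauchyDevelopment D', 𝒟.IsMaximal →
          Summit.FinalStateConjecture.HasCompleteNullInfinity 𝒟.toCauchyDevelopment ∧
            ∃ (O : Set 𝒟.carrier) (d : Literature.Geometry.Lorentzian.FinalStateDecomposition 𝒟.toSpacetime O 2),
              (∀ i, Literature.Geometry.Lorentzian.Kerr.IsSubextremal (d.mass i) (d.spin i)) ∧
              O = Summit.FinalStateConjecture.exteriorOf 𝒟.toCauchyDevelopment d.charted ∧
              Summit.FinalStateConjecture.RaysStayInClosure 𝒟.toCauchyDevelopment O ∧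
              Summit.FinalStateConjecture.HasExhaustiveCharts d ∧
              Summit.FinalStateConjecture.IsFutureOriented d) := by
    intro D' hD' h
    refine ⟨h.1, fun 𝒟 h𝒟 ↦ ⟨(h.2 𝒟 h𝒟).1, ?_⟩⟩
    by_cases hH : (∀ [𝒟.metric.HasLeviCivita], ∃ q : 𝒟.carrier, ∀ (p : X) (γ : ℝ → 𝒟.carrier) (dom : Set ℝ),
        𝒟.metric.IsNormalisedNullRayFrom 𝒟.timeOrientation 𝒟.embed 𝒟.normal p γ dom →
        ¬ BddAbove dom → q ∉ 𝒟.metric.chronologicalPast 𝒟.timeOrientation (γ '' (dom ∩ Set.Ici 0)))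
    · exact (h.2 𝒟 h𝒟).2 hH
    · obtain ⟨O, d, hN, hO, hR, hE, hF⟩ := hA X D' hD' 𝒟 h𝒟 (h.2 𝒟 h𝒟).1 hH
      exact ⟨O, d, fun i ↦ (Fin.cast hN i).elim0, hO, hR, hE, hF⟩
  obtain ⟨e, F, hT, hImm, h0, hinj, hF𝓓, hE⟩ := hG X D ⟨hD.1, fun h ↦ hD.2 (key D hD.1 h)⟩
  exact ⟨e, F, hT, hImm, h0, hinj, hF𝓓, fun c hc hmem ↦ hE c hc ⟨hmem.1, fun h ↦ hmem.2 (key _ hmem.1 h)⟩⟩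

/-- **The route's deciding theorem survives the restatement C‴ verbatim**: `HorizonlessMustDrain →
DrainImpliesDisperseH → GenericCensoredHolesSettle → FinalStateConjecture`. [folklore] -/
theorem closes_H : HorizonlessMustDrain → DrainImpliesDisperseH → GenericCensoredHolesSettle →
    _root_.FinalStateConjecture :=
  fun hM hΔ hG ↦ finalStateConjecture_of_censoredHorizonlessDisperse (censoredHorizonlessDisperse_of_H hM hΔ) hG

/-! ## The route survives C″ by the surgery R4: `closes_R4` -/

/-- The CK-restricted composite from the CK-restricted strokes. [folklore] -/
theorem censoredHorizonlessDisperseCK_of (hM : HorizonlessMustDrain) (hΔ : DrainImpliesDisperseCKH) :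
    CensoredHorizonlessDisperseCK := by
  intro X _ _ _ _ _ _ D hD hCK 𝒟 h𝒟 hI hH
  exact hΔ X D hD hCK 𝒟 h𝒟 hI hH (hM X D hD 𝒟 h𝒟 hI hH)

/-- **Surgery R4** (REPORT-c3 §5 R4, made precise): with the dispersive items restricted to CK data and the generic
branch absorbing the rough horizonless data, the route still decides the (unchanged, DR-class) Statement:
`CensoredHorizonlessDisperseCK → GenericCensoredHolesSettleR4 → FinalStateConjecture` — case split on the horizon,
then on CK-regularity of the datum; sub-extremality is vacuous over `Fin 0`; tame genericity is monotone in the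
property. [folklore] -/
theorem finalStateConjecture_of_censoredHorizonlessDisperseCK (hA : CensoredHorizonlessDisperseCK)
    (hG : GenericCensoredHolesSettleR4) : _root_.FinalStateConjecture := by
  intro X _ _ _ _ _ _ D hD
  have key : ∀ D' ∈ Literature.Geometry.Lorentzian.admissibleVacuumData X,
      ((∃ 𝒟 : Literature.Geometry.Lorentzian.VacuumCauchyDevelopment D', 𝒟.IsMaximal) ∧
        ∀ 𝒟 : Literature.Geometry.Lorentzian.VacuumCauchyDevelopment D', 𝒟.IsMaximal →
          Summit.FinalStateConjecture.HasCompleteNullInfinity 𝒟.toCauchyDevelopment ∧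
          (((∀ [𝒟.metric.HasLeviCivita], ∃ q : 𝒟.carrier, ∀ (p : X) (γ : ℝ → 𝒟.carrier) (dom : Set ℝ),
              𝒟.metric.IsNormalisedNullRayFrom 𝒟.timeOrientation 𝒟.embed 𝒟.normal p γ dom →
              ¬ BddAbove dom → q ∉ 𝒟.metric.chronologicalPast 𝒟.timeOrientation (γ '' (dom ∩ Set.Ici 0))) ∨
            ¬ (∃ (e : Literature.Geometry.Lorentzian.AFEnd X) (M : ℝ),
                e.IsSoleEnd ∧ e.IsStronglyAsymptoticallyFlatCK D' M)) →
            ∃ (O : Set 𝒟.carrier) (d : Literature.Geometry.Lorentzian.FinalStateDecomposition 𝒟.toSpacetime O 2),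
              (∀ i, Literature.Geometry.Lorentzian.Kerr.IsSubextremal (d.mass i) (d.spin i)) ∧
              O = Summit.FinalStateConjecture.exteriorOf 𝒟.toCauchyDevelopment d.charted ∧
              Summit.FinalStateConjecture.RaysStayInClosure 𝒟.toCauchyDevelopment O ∧
              Summit.FinalStateConjecture.HasExhaustiveCharts d ∧
              Summit.FinalStateConjecture.IsFutureOriented d)) →
      ((∃ 𝒟 : Literature.Geometry.Lorentzian.VacuumCauchyDevelopment D', 𝒟.IsMaximal) ∧
        ∀ 𝒟 : Literature.Geometry.Lorentzian.VacuumCauchyDevelopment D', 𝒟.IsMaximal →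
          Summit.FinalStateConjecture.HasCompleteNullInfinity 𝒟.toCauchyDevelopment ∧
            ∃ (O : Set 𝒟.carrier) (d : Literature.Geometry.Lorentzian.FinalStateDecomposition 𝒟.toSpacetime O 2),
              (∀ i, Literature.Geometry.Lorentzian.Kerr.IsSubextremal (d.mass i) (d.spin i)) ∧
              O = Summit.FinalStateConjecture.exteriorOf 𝒟.toCauchyDevelopment d.charted ∧
              Summit.FinalStateConjecture.RaysStayInClosure 𝒟.toCauchyDevelopment O ∧
              Summit.FinalStateConjecture.HasExhaustiveCharts d ∧
              Summit.FinalStateConjecture.IsFutureOriented d) := by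
    intro D' hD' h
    refine ⟨h.1, fun 𝒟 h𝒟 ↦ ⟨(h.2 𝒟 h𝒟).1, ?_⟩⟩
    by_cases hH : (∀ [𝒟.metric.HasLeviCivita], ∃ q : 𝒟.carrier, ∀ (p : X) (γ : ℝ → 𝒟.carrier) (dom : Set ℝ),
        𝒟.metric.IsNormalisedNullRayFrom 𝒟.timeOrientation 𝒟.embed 𝒟.normal p γ dom →
        ¬ BddAbove dom → q ∉ 𝒟.metric.chronologicalPast 𝒟.timeOrientation (γ '' (dom ∩ Set.Ici 0)))
    · -- event horizon: the generic branch settles the exterior directly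
      exact (h.2 𝒟 h𝒟).2 (Or.inl hH)
    · by_cases hCK : ∃ (e : Literature.Geometry.Lorentzian.AFEnd X) (M : ℝ),
          e.IsSoleEnd ∧ e.IsStronglyAsymptoticallyFlatCK D' M
      · -- CK data, no horizon: the CK-restricted dispersive branch
        obtain ⟨O, d, hN, hO, hR, hE, hF⟩ := hA X D' hD' hCK 𝒟 h𝒟 (h.2 𝒟 h𝒟).1 hH
        exact ⟨O, d, fun i ↦ (Fin.cast hN i).elim0, hO, hR, hE, hF⟩
      · -- rough data, no horizon: absorbed by the generic branch (R4)
        exact (h.2 𝒟 h𝒟).2 (Or.inr hCK)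
  obtain ⟨e, F, hT, hImm, h0, hinj, hF𝓓, hE⟩ := hG X D ⟨hD.1, fun h ↦ hD.2 (key D hD.1 h)⟩
  exact ⟨e, F, hT, hImm, h0, hinj, hF𝓓, fun c hc hmem ↦ hE c hc ⟨hmem.1, fun h ↦ hmem.2 (key _ hmem.1 h)⟩⟩

/-- **The route's deciding theorem after the surgery R4**: `HorizonlessMustDrain → DrainImpliesDisperseCKH →
GenericCensoredHolesSettleR4 → FinalStateConjecture`. [folklore] -/
theorem closes_R4 : HorizonlessMustDrain → DrainImpliesDisperseCKH → GenericCensoredHolesSettleR4 →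
    _root_.FinalStateConjecture :=
  fun hM hΔ hG ↦ finalStateConjecture_of_censoredHorizonlessDisperseCK (censoredHorizonlessDisperseCK_of hM hΔ) hG

/-- The R4 generic branch is implied by the Statement itself (so R4 does not overshoot the summit): the Statement's
property gives the decomposition unconditionally. [folklore] -/
theorem genericCensoredHolesSettleR4_of_finalStateConjecture (h : _root_.FinalStateConjecture) :
    GenericCensoredHolesSettleR4 := by
  intro X _ _ _ _ _ _
  obtain hgen := h X
  -- monotonicity of tame genericity in the property, in the other direction (P ⊆ P′)
  intro D hD
  have key : ∀ D' ∈ Literature.Geometry.Lorentzian.admissibleVacuumData X,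
      ((∃ 𝒟 : Literature.Geometry.Lorentzian.VacuumCauchyDevelopment D', 𝒟.IsMaximal) ∧
        ∀ 𝒟 : Literature.Geometry.Lorentzian.VacuumCauchyDevelopment D', 𝒟.IsMaximal →
          Summit.FinalStateConjecture.HasCompleteNullInfinity 𝒟.toCauchyDevelopment ∧
            ∃ (O : Set 𝒟.carrier) (d : Literature.Geometry.Lorentzian.FinalStateDecomposition 𝒟.toSpacetime O 2),
              (∀ i, Literature.Geometry.Lorentzian.Kerr.IsSubextremal (d.mass i) (d.spin i)) ∧
              O = Summit.FinalStateConjecture.exteriorOf 𝒟.toCauchyDevelopment d.charted ∧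
              Summit.FinalStateConjecture.RaysStayInClosure 𝒟.toCauchyDevelopment O ∧
              Summit.FinalStateConjecture.HasExhaustiveCharts d ∧
              Summit.FinalStateConjecture.IsFutureOriented d) →
      ((∃ 𝒟 : Literature.Geometry.Lorentzian.VacuumCauchyDevelopment D', 𝒟.IsMaximal) ∧
        ∀ 𝒟 : Literature.Geometry.Lorentzian.VacuumCauchyDevelopment D', 𝒟.IsMaximal →
          Summit.FinalStateConjecture.HasCompleteNullInfinity 𝒟.toCauchyDevelopment ∧
          (((∀ [𝒟.metric.HasLeviCivita], ∃ q : 𝒟.carrier, ∀ (p : X) (γ : ℝ → 𝒟.carrier) (dom : Set ℝ),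
              𝒟.metric.IsNormalisedNullRayFrom 𝒟.timeOrientation 𝒟.embed 𝒟.normal p γ dom →
              ¬ BddAbove dom → q ∉ 𝒟.metric.chronologicalPast 𝒟.timeOrientation (γ '' (dom ∩ Set.Ici 0))) ∨
            ¬ (∃ (e : Literature.Geometry.Lorentzian.AFEnd X) (M : ℝ),
                e.IsSoleEnd ∧ e.IsStronglyAsymptoticallyFlatCK D' M)) →
            ∃ (O : Set 𝒟.carrier) (d : Literature.Geometry.Lorentzian.FinalStateDecomposition 𝒟.toSpacetime O 2),
              (∀ i, Literature.Geometry.Lorentzian.Kerr.IsSubextremal (d.mass i) (d.spin i)) ∧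
              O = Summit.FinalStateConjecture.exteriorOf 𝒟.toCauchyDevelopment d.charted ∧
              Summit.FinalStateConjecture.RaysStayInClosure 𝒟.toCauchyDevelopment O ∧
              Summit.FinalStateConjecture.HasExhaustiveCharts d ∧
              Summit.FinalStateConjecture.IsFutureOriented d)) := by
    intro D' hD' h
    exact ⟨h.1, fun 𝒟 h𝒟 ↦ ⟨(h.2 𝒟 h𝒟).1, fun _ ↦ (h.2 𝒟 h𝒟).2⟩⟩
  obtain ⟨e, F, hT, hImm, h0, hinj, hF𝓓, hE⟩ := hgen D ⟨hD.1, fun h' ↦ hD.2 (key D hD.1 h')⟩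
  exact ⟨e, F, hT, hImm, h0, hinj, hF𝓓, fun c hc hmem ↦ hE c hc ⟨hmem.1, fun h' ↦ hmem.2 (key _ hmem.1 h')⟩⟩

end Summit.FinalStateConjecture.FinalStateConjecture.Cruxes.DrainImpliesDisperse.Surgery

end
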